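import Summits.CriticalPhenomena.PercolationContinuityZ3.Theorems.PercNearOneGluingNoHeavyLowerTailForestConnMonotone
import HarnessLib

/-!
# Monotone connection probabilities imply positively correlated connection events — class-relative form

Companion of `…ForestConnMonotone`: the same Harris-type induction for pinned families
`𝓕(D;K) = {G ⊆ D : P (G ∪ K)}`, but with the single-coordinate monotonicity hypothesis assumed
only inside a fixed ambient set `E₀` (the induction never leaves `D ∪ K ⊆ E₀`). This is the form
in which Theorem A of memo KCLUSTER-gen86 («forest negative correlation on all minors ⟹ positive
correlation of connection events of the uniform spanning forest») applies to a minor-closed CLASS,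
e.g. the independence-correlated class of Semple–Welsh (*Negative correlation in graphs and
matroids*, CPC 2008, Thm 4.2/4.4: series–parallel graphs, `K₄` and minors; closed under minors,
series–parallel extension, 2-sums), where the hypothesis is a published theorem.

Theorems only; no definitions, no `sorry`.
-/

open Finset SimpleGraph

namespace Summit.CriticalPhenomena.PercolationContinuityZ3.Theorems.ConnMonotone

/-! ### §1 Class-relative form (ambient edge set `E₀`)

The induction behind `card_mul_card_inter_ge_of_monotone` only visits pinned families `𝓕(D';K')`
with `D' ∪ K' ⊆ D ∪ K`. Hence the hypothesis is only needed INSIDE a fixed ambient set `E₀`: this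
is the form in which the theorem applies to a minor-closed CLASS of graphs (e.g. the
independence-correlated class of Semple–Welsh, where forest negative correlation is known). -/

section Relative

variable {α : Type*} [DecidableEq α]

/-- **Monotone influences imply positive correlation, relative to an ambient set `E₀`.** As
`card_mul_card_inter_ge_of_monotone`, but the single-coordinate monotonicity of `U` and `W` is
only assumed for pinned families `𝓕(D;K)`, `𝓕(D;K ∪ f)` with `D ∪ (K ∪ f) ⊆ E₀`, and the
conclusion is drawn for every `𝓕(D;K)` with `D ∪ K ⊆ E₀`, `D ∩ K = ∅`. [Harris-type induction;
elementary] -/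
theorem card_mul_card_inter_ge_of_monotone_on (E₀ : Finset α) (P U W : Finset α → Prop)
    [DecidablePred P] [DecidablePred U] [DecidablePred W]
    (hU : ∀ (D K : Finset α) (f : α), f ∉ D → f ∉ K → D ∪ insert f K ⊆ E₀ →
      #((D.powerset.filter fun G => P (G ∪ K)).filter fun G => U (G ∪ K)) *
          #(D.powerset.filter fun G => P (G ∪ insert f K)) ≤
        #((D.powerset.filter fun G => P (G ∪ insert f K)).filter fun G => U (G ∪ insert f K)) *
          #(D.powerset.filter fun G => P (G ∪ K)))
    (hW : ∀ (D K : Finset α) (f : α), f ∉ D → f ∉ K → D ∪ insert f K ⊆ E₀ →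
      #((D.powerset.filter fun G => P (G ∪ K)).filter fun G => W (G ∪ K)) *
          #(D.powerset.filter fun G => P (G ∪ insert f K)) ≤
        #((D.powerset.filter fun G => P (G ∪ insert f K)).filter fun G => W (G ∪ insert f K)) *
          #(D.powerset.filter fun G => P (G ∪ K)))
    (D K : Finset α) (hDK : Disjoint D K) (hE : D ∪ K ⊆ E₀) :
    #((D.powerset.filter fun G => P (G ∪ K)).filter fun G => U (G ∪ K)) *
        #((D.powerset.filter fun G => P (G ∪ K)).filter fun G => W (G ∪ K)) ≤
      #(D.powerset.filter fun G => P (G ∪ K)) *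
        #((D.powerset.filter fun G => P (G ∪ K)).filter fun G => U (G ∪ K) ∧ W (G ∪ K)) := by
  simp only [Finset.filter_filter]
  obtain ⟨n, hn⟩ : ∃ n, D.card = n := ⟨_, rfl⟩
  induction n generalizing D K with
  | zero =>
    have hD : D = ∅ := Finset.card_eq_zero.1 hn
    subst hD
    simp only [Finset.powerset_empty, Finset.filter_singleton, Finset.empty_union]
    by_cases hP : P K <;> by_cases hU' : U K <;> by_cases hW' : W K <;> simp [hP, hU', hW']
  | succ n ih =>
    obtain ⟨f, hf⟩ : D.Nonempty := Finset.card_pos.1 (by omega)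
    have hfK : f ∉ K := fun h => Finset.disjoint_left.1 hDK hf h
    have hcard : (D.erase f).card = n := by rw [Finset.card_erase_of_mem hf, hn]; rfl
    have hfD' : f ∉ D.erase f := Finset.notMem_erase f D
    have hdis₁ : Disjoint (D.erase f) K :=
      (Finset.disjoint_of_subset_left (Finset.erase_subset f D) hDK)
    have hdis₂ : Disjoint (D.erase f) (insert f K) := by
      rw [Finset.disjoint_insert_right]; exact ⟨hfD', hdis₁⟩
    have hE₂ : D.erase f ∪ insert f K ⊆ E₀ := by
      intro x hx
      apply hE
      rcases Finset.mem_union.1 hx with hx | hx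
      · exact Finset.mem_union.2 (Or.inl (Finset.mem_of_mem_erase hx))
      · rcases Finset.mem_insert.1 hx with rfl | hx
        · exact Finset.mem_union.2 (Or.inl hf)
        · exact Finset.mem_union.2 (Or.inr hx)
    have hE₁ : D.erase f ∪ K ⊆ E₀ := fun x hx => hE (by
      rcases Finset.mem_union.1 hx with hx | hx
      · exact Finset.mem_union.2 (Or.inl (Finset.mem_of_mem_erase hx))
      · exact Finset.mem_union.2 (Or.inr hx))
    have sN := card_pinned_split (fun X => P X) D K hf
    have sU := card_pinned_split (fun X => P X ∧ U X) D K hf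
    have sW := card_pinned_split (fun X => P X ∧ W X) D K hf
    have sUW := card_pinned_split (fun X => P X ∧ (U X ∧ W X)) D K hf
    rw [sN, sU, sW, sUW]
    have ih₁ := ih (D.erase f) K hdis₁ hE₁ hcard
    have ih₂ := ih (D.erase f) (insert f K) hdis₂ hE₂ hcard
    have mU := hU (D.erase f) K f hfD' hfK hE₂
    have mW := hW (D.erase f) K f hfD' hfK hE₂
    simp only [Finset.filter_filter] at mU mW
    have bU : ∀ K' : Finset α,
        #((D.erase f).powerset.filter fun G => P (G ∪ K') ∧ U (G ∪ K')) ≤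
          #((D.erase f).powerset.filter fun G => P (G ∪ K')) := fun K' =>
      Finset.card_le_card fun G hG => by
        simp only [Finset.mem_filter] at hG ⊢
        exact ⟨hG.1, hG.2.1⟩
    have bW : ∀ K' : Finset α,
        #((D.erase f).powerset.filter fun G => P (G ∪ K') ∧ W (G ∪ K')) ≤
          #((D.erase f).powerset.filter fun G => P (G ∪ K')) := fun K' =>
      Finset.card_le_card fun G hG => by
        simp only [Finset.mem_filter] at hG ⊢
        exact ⟨hG.1, hG.2.1⟩
    have mU' := ((mul_comm _ _).trans_le mU).trans_eq (mul_comm _ _)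
    have mW' := ((mul_comm _ _).trans_le mW).trans_eq (mul_comm _ _)
    exact mixture_le _ _ _ _ _ _ _ _ ih₁ ih₂ mU' mW' (bU K) (bW K) (bU _) (bW _)

end Relative

section ForestsRelative
open scoped Classical

variable {V : Type*} [DecidableEq V]

/-- **Theorem A relative to an ambient graph `E₀`.** If, for every minor of the finite edge system
`E₀` (spanning forests `𝓕(D;K)` of `⟨D ∪ K⟩/K`, `D ∪ K ⊆ E₀`), the connection probabilities of
the uniform spanning forest are nondecreasing under insertion of an edge of `E₀` (⟺ negative edge
correlation of uniform forests on all minors of `E₀`), then on every such minor the connection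
events are positively correlated:
`#𝓕(D;K)[a~b] · #𝓕(D;K)[c~d] ≤ #𝓕(D;K) · #𝓕(D;K)[a~b ∧ c~d]`. By Semple–Welsh (CPC 2008,
Thm 4.2/4.4) the hypothesis is a theorem when `⟨E₀⟩` is series–parallel (more generally in their
independence-correlated class); that discharge is not formalised here. [memo KCLUSTER-gen86 Thm A] -/
theorem forests_conn_posCorr_of_connMonotone_on (E₀ : Finset (Sym2 V))
    (hmono : ∀ (D K : Finset (Sym2 V)) (f : Sym2 V) (x y : V), f ∉ D → f ∉ K →
      D ∪ insert f K ⊆ E₀ →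
      #((D.powerset.filter fun G => (fromEdgeSet ((G ∪ K : Finset (Sym2 V)) : Set (Sym2 V))).IsAcyclic).filter
            fun G => (fromEdgeSet ((G ∪ K : Finset (Sym2 V)) : Set (Sym2 V))).Reachable x y) *
          #(D.powerset.filter fun G =>
            (fromEdgeSet ((G ∪ insert f K : Finset (Sym2 V)) : Set (Sym2 V))).IsAcyclic) ≤
        #((D.powerset.filter fun G =>
            (fromEdgeSet ((G ∪ insert f K : Finset (Sym2 V)) : Set (Sym2 V))).IsAcyclic).filter
            fun G => (fromEdgeSet ((G ∪ insert f K : Finset (Sym2 V)) : Set (Sym2 V))).Reachable x y) *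
          #(D.powerset.filter fun G => (fromEdgeSet ((G ∪ K : Finset (Sym2 V)) : Set (Sym2 V))).IsAcyclic))
    (D K : Finset (Sym2 V)) (hDK : Disjoint D K) (hE : D ∪ K ⊆ E₀) (a b c d : V) :
    #((D.powerset.filter fun G => (fromEdgeSet ((G ∪ K : Finset (Sym2 V)) : Set (Sym2 V))).IsAcyclic).filter
          fun G => (fromEdgeSet ((G ∪ K : Finset (Sym2 V)) : Set (Sym2 V))).Reachable a b) *
        #((D.powerset.filter fun G => (fromEdgeSet ((G ∪ K : Finset (Sym2 V)) : Set (Sym2 V))).IsAcyclic).filter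
          fun G => (fromEdgeSet ((G ∪ K : Finset (Sym2 V)) : Set (Sym2 V))).Reachable c d) ≤
      #(D.powerset.filter fun G => (fromEdgeSet ((G ∪ K : Finset (Sym2 V)) : Set (Sym2 V))).IsAcyclic) *
        #((D.powerset.filter fun G => (fromEdgeSet ((G ∪ K : Finset (Sym2 V)) : Set (Sym2 V))).IsAcyclic).filter
          fun G => (fromEdgeSet ((G ∪ K : Finset (Sym2 V)) : Set (Sym2 V))).Reachable a b ∧
            (fromEdgeSet ((G ∪ K : Finset (Sym2 V)) : Set (Sym2 V))).Reachable c d) :=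
  card_mul_card_inter_ge_of_monotone_on E₀
    (fun X => (fromEdgeSet ((X : Finset (Sym2 V)) : Set (Sym2 V))).IsAcyclic)
    (fun X => (fromEdgeSet ((X : Finset (Sym2 V)) : Set (Sym2 V))).Reachable a b)
    (fun X => (fromEdgeSet ((X : Finset (Sym2 V)) : Set (Sym2 V))).Reachable c d)
    (fun D K f hf hfK hE' => hmono D K f a b hf hfK hE')
    (fun D K f hf hfK hE' => hmono D K f c d hf hfK hE') D K hDK hE

/-- **Unpinned class-relative form**: under the hypothesis of
`forests_conn_posCorr_of_connMonotone_on` for the ambient edge system `E₀`, the connection events of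
the uniform spanning forest of every sub-system `D ⊆ E₀` are positively correlated:
`#{a ~_F b} · #{c ~_F d} ≤ #𝓕(D) · #{a ~_F b ∧ c ~_F d}`. [memo KCLUSTER-gen86 Thm A] -/
theorem forests_conn_posCorr_of_connMonotone_on_unpinned (E₀ : Finset (Sym2 V))
    (hmono : ∀ (D K : Finset (Sym2 V)) (f : Sym2 V) (x y : V), f ∉ D → f ∉ K →
      D ∪ insert f K ⊆ E₀ →
      #((D.powerset.filter fun G => (fromEdgeSet ((G ∪ K : Finset (Sym2 V)) : Set (Sym2 V))).IsAcyclic).filter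
            fun G => (fromEdgeSet ((G ∪ K : Finset (Sym2 V)) : Set (Sym2 V))).Reachable x y) *
          #(D.powerset.filter fun G =>
            (fromEdgeSet ((G ∪ insert f K : Finset (Sym2 V)) : Set (Sym2 V))).IsAcyclic) ≤
        #((D.powerset.filter fun G =>
            (fromEdgeSet ((G ∪ insert f K : Finset (Sym2 V)) : Set (Sym2 V))).IsAcyclic).filter
            fun G => (fromEdgeSet ((G ∪ insert f K : Finset (Sym2 V)) : Set (Sym2 V))).Reachable x y) *
          #(D.powerset.filter fun G => (fromEdgeSet ((G ∪ K : Finset (Sym2 V)) : Set (Sym2 V))).IsAcyclic))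
    (D : Finset (Sym2 V)) (hD : D ⊆ E₀) (a b c d : V) :
    #((D.powerset.filter fun G => (fromEdgeSet ((G : Finset (Sym2 V)) : Set (Sym2 V))).IsAcyclic).filter
          fun G => (fromEdgeSet ((G : Finset (Sym2 V)) : Set (Sym2 V))).Reachable a b) *
        #((D.powerset.filter fun G => (fromEdgeSet ((G : Finset (Sym2 V)) : Set (Sym2 V))).IsAcyclic).filter
          fun G => (fromEdgeSet ((G : Finset (Sym2 V)) : Set (Sym2 V))).Reachable c d) ≤
      #(D.powerset.filter fun G => (fromEdgeSet ((G : Finset (Sym2 V)) : Set (Sym2 V))).IsAcyclic) *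
        #((D.powerset.filter fun G => (fromEdgeSet ((G : Finset (Sym2 V)) : Set (Sym2 V))).IsAcyclic).filter
          fun G => (fromEdgeSet ((G : Finset (Sym2 V)) : Set (Sym2 V))).Reachable a b ∧
            (fromEdgeSet ((G : Finset (Sym2 V)) : Set (Sym2 V))).Reachable c d) := by
  simpa only [Finset.union_empty] using
    forests_conn_posCorr_of_connMonotone_on E₀ hmono D ∅ (Finset.disjoint_empty_right D)
      (by simpa only [Finset.union_empty] using hD) a b c d

end ForestsRelative

end Summit.CriticalPhenomena.PercolationContinuityZ3.Theorems.ConnMonotone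

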